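/-
Copyright (c) 2026 the pub-hodgecm-mathlib formalisation cell (harness21).  Prover seat hodgecm-mathlib-K2Liu-p05 (g3), 2026-09-04
(Track B «K2-LIT», crux hLiu418 = stmt-HodgeConjecture-24832, socket #42F′ `sig_K2LiuFirstTermIdentityOnGenerators`, ROAD I v3, organ G2-Weil, sub-organ
(G2-W1) FILE 2∕2: closed forms, linear independence, spanning, the adapted basis of `𝔲(2,2)` and its exponential table).
-/
import Summits.HodgeConjecture.HodgeConjecture.Theorems.K2LiuU22AdaptedBasisDefs   -- (G2-W1) file 1∕2: generators, letters, `exp (s X_i) = g_i L_i(s) g_i⁻¹`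
import HarnessLib

/-!
# (G2-W1, file 2∕2) The adapted basis `u22AdaptedBasis : Module.Basis (Fin 16) ℝ 𝔲(2,2)` and its exponential table

Track B ∕ K2-LIT, hLiu418 = stmt-HodgeConjecture-24832, #42F′ ROAD I v3 organ G2-Weil, sub-organ (G2-W1) — the `U(2,2)` twin of ★
`KonnoKonno2007.JunctionLinearRealGroup` §3 («Closed forms, linear independence, spanning: `u21AdaptedBasis`»).  Namespace
`Summit.HodgeConjecture.HodgeConjecture.Cruxes.HLiu418.K2LiuU22AdaptedBasis` (continued).  DEFINITIONS WITH BODIES + theorems (review lane; no instance, no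
notation, no attribute, no named fact, no `sorry`); `--supports stmt-HodgeConjecture-24832 --as helper`.

* `u22GenExplicit` — the sixteen generators in closed form (entries in `ℚ(i)`): `iE₀₀, iE₁₁, iE₂₂, iE₃₃`; in the `U(2)_α` block
  `(i∕25)(−7(E₀₀−E₁₁) − 24(E₀₁+E₁₀))` and `(1∕25)(−7i(E₀₀−E₁₁) − 24E₀₁ + 24E₁₀)`, the same two in the `U(2)_β` block; `Y₀₀, Y₀₁, Y₁₀, Y₁₁`; `Z₀₀, Z₀₁, Z₁₀, Z₁₁`
  (`u22Gen_eq_explicit`: `g_i X⁰_i g_i⁻¹` computed).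
* `linearIndependent_u22Gen` (read off sixteen real coordinates of the entries), `u22Coeff` + `eq_sum_u22Coeff_smul` (every `X ∈ 𝔲(2,2)`, i.e.
  `Xᴴ D + D X = 0`, `D = diag(1,1,−1,−1)`, is `∑ u22Coeff X i • X_i`), `mem_span_u22Gen`.
* **`u22AdaptedBasis`** (`Module.Basis.mk`), `finrank_u22Lie : dim_ℝ 𝔲(2,2) = 16`, `coe_u22AdaptedBasis`, and THE EXPONENTIAL TABLE IN `U(2,2)` in the shape
  consumed by ★ `RealMatrixGroup.contDiffAt_apply_of_letters` ∕ `ArchimedeanSecondKindChart`: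
  **`expMem_smul_u22AdaptedBasis : (uFormGroup (Fin 2) (Fin 2)).expMem (s • u22AdaptedBasis i) = kV (u22FrameK i) * letterOf (u22Kind i) s * (kV (u22FrameK i))⁻¹`**.

HONEST LABEL: HC_CM is proved only modulo the 7 printed citations (2 remaining named inputs: hLiu418 = stmt-HodgeConjecture-24832, h413 =
stmt-HodgeConjecture-24833) until rung 0 closes; organ capital (G2-W1) for #42F′'s Road I, moves no counter.

## References
* [Knapp2002] A. W. Knapp, *Lie Groups Beyond an Introduction*, 2nd ed. (2002), I.§1 Example (3), VI.§2.
* [KonnoKonno2007] K. Konno, T. Konno, Kyushu J. Math. 61 (2007), §3.1.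
-/

set_option autoImplicit false
set_option linter.dupNamespace false

noncomputable section

open scoped MatrixGroups Matrix ComplexConjugate
open NormedSpace -- for `exp`
open Literature.NumberTheory.Automorphic
open Literature.RepresentationTheory.KonnoKonno2007
open Literature.RepresentationTheory.KonnoKonno2007.RealDualPair
open Literature.RepresentationTheory.KonnoKonno2007.RealDualPair.UForm
open Literature.Analysis.SegalBargmann
open Complex (I)

-- Mathlib idiom (`Mathlib/Algebra/Lie/OfAssociative.lean`), as in ★ `RealMatrixGroups` ∕ `JunctionLinearRealGroup`: the commutator bracket on
-- `Matrix n n ℂ`, needed to mention the Lie subalgebra `(uFormGroup α β).lie` and its underlying real vector space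
attribute [local instance 100] LieRing.ofAssociativeRing

namespace Summit.HodgeConjecture.HodgeConjecture.Cruxes.HLiu418.K2LiuU22AdaptedBasis

/-! ## Closed forms -/

/-- the `U(2)`-block matrix `(i∕25)(−7, −24; −24, 7)` = `Ad(w)(i(E₀₀ − E₁₁))`. [folklore] -/
def offDiagA : Matrix (Fin 2) (Fin 2) ℂ := !![-(7 / 25 : ℂ) * I, -(24 / 25 : ℂ) * I; -(24 / 25 : ℂ) * I, (7 / 25 : ℂ) * I]

/-- the `U(2)`-block matrix `(1∕25)(−7i, −24; 24, 7i)` = `Ad(d₁w)(i(E₀₀ − E₁₁))`. [folklore] -/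
def offDiagB : Matrix (Fin 2) (Fin 2) ℂ := !![-(7 / 25 : ℂ) * I, -(24 / 25 : ℂ); (24 / 25 : ℂ), (7 / 25 : ℂ) * I]

/-- **The adapted generators, explicitly**: `iE₀₀, iE₁₁, iE₂₂, iE₃₃`, the two rotated compact directions of each `U(2)` factor, `Y_{pq}`, `Z_{pq}` —
all entries in `ℚ(i)`. [folklore] -/
def u22GenExplicit : Fin 16 → Matrix (Fin 2 ⊕ Fin 2) (Fin 2 ⊕ Fin 2) ℂ :=
  ![torusGen ![-1, 0] 0, torusGen ![0, -1] 0, torusGen 0 ![-1, 0], torusGen 0 ![0, -1],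
    Matrix.fromBlocks offDiagA 0 0 0, Matrix.fromBlocks offDiagB 0 0 0, Matrix.fromBlocks 0 0 0 offDiagA, Matrix.fromBlocks 0 0 0 offDiagB,
    boostGen 0 0, boostGen 0 1, boostGen 1 0, boostGen 1 1,
    realBoostGen 0 0, realBoostGen 0 1, realBoostGen 1 0, realBoostGen 1 1]

/-- a sum over `Fin 16`, written out. [folklore] -/
theorem sum_univ_sixteen {M : Type*} [AddCommMonoid M] (f : Fin 16 → M) :
    ∑ i, f i = f 0 + f 1 + f 2 + f 3 + f 4 + f 5 + f 6 + f 7 + f 8 + f 9 + f 10 + f 11 + f 12 + f 13 + f 14 + f 15 := by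
  rw [Fin.sum_univ_castSucc, Fin.sum_univ_castSucc, Fin.sum_univ_castSucc, Fin.sum_univ_castSucc, Fin.sum_univ_castSucc, Fin.sum_univ_castSucc,
    Fin.sum_univ_castSucc, Fin.sum_univ_castSucc, Fin.sum_univ_eight]
  rfl

/-- `X_0 = g_0 X⁰_0 g_0⁻¹` computed. [folklore] -/
theorem u22Gen_eq_explicit_0 : u22Gen 0 = u22GenExplicit 0 := by
  rw [u22Gen, Units.mul_inv_eq_iff_eq_mul]
  ext x y
  rcases x with a | b <;> rcases y with a' | b' <;> (try fin_cases a) <;> (try fin_cases b) <;> (try fin_cases a') <;> (try fin_cases b') <;>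
    simp [u22AdaptedConj, u22FrameK, u22BaseGen, u22Kind, u22GenExplicit, offDiagA, offDiagB, Matrix.mul_apply, Matrix.one_apply]

/-- `X_1 = g_1 X⁰_1 g_1⁻¹` computed. [folklore] -/
theorem u22Gen_eq_explicit_1 : u22Gen 1 = u22GenExplicit 1 := by
  rw [u22Gen, Units.mul_inv_eq_iff_eq_mul]
  ext x y
  rcases x with a | b <;> rcases y with a' | b' <;> (try fin_cases a) <;> (try fin_cases b) <;> (try fin_cases a') <;> (try fin_cases b') <;>
    simp [u22AdaptedConj, u22FrameK, u22BaseGen, u22Kind, u22GenExplicit, offDiagA, offDiagB, Matrix.mul_apply, Matrix.one_apply]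

/-- `X_2 = g_2 X⁰_2 g_2⁻¹` computed. [folklore] -/
theorem u22Gen_eq_explicit_2 : u22Gen 2 = u22GenExplicit 2 := by
  rw [u22Gen, Units.mul_inv_eq_iff_eq_mul]
  ext x y
  rcases x with a | b <;> rcases y with a' | b' <;> (try fin_cases a) <;> (try fin_cases b) <;> (try fin_cases a') <;> (try fin_cases b') <;>
    simp [u22AdaptedConj, u22FrameK, u22BaseGen, u22Kind, u22GenExplicit, offDiagA, offDiagB, Matrix.mul_apply, Matrix.one_apply]

/-- `X_3 = g_3 X⁰_3 g_3⁻¹` computed. [folklore] -/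
theorem u22Gen_eq_explicit_3 : u22Gen 3 = u22GenExplicit 3 := by
  rw [u22Gen, Units.mul_inv_eq_iff_eq_mul]
  ext x y
  rcases x with a | b <;> rcases y with a' | b' <;> (try fin_cases a) <;> (try fin_cases b) <;> (try fin_cases a') <;> (try fin_cases b') <;>
    simp [u22AdaptedConj, u22FrameK, u22BaseGen, u22Kind, u22GenExplicit, offDiagA, offDiagB, Matrix.mul_apply, Matrix.one_apply]

/-- `X_4 = g_4 X⁰_4 g_4⁻¹` computed. [folklore] -/
theorem u22Gen_eq_explicit_4 : u22Gen 4 = u22GenExplicit 4 := by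
  rw [u22Gen, Units.mul_inv_eq_iff_eq_mul]
  ext x y
  rcases x with a | b <;> rcases y with a' | b' <;> (try fin_cases a) <;> (try fin_cases b) <;> (try fin_cases a') <;> (try fin_cases b') <;>
    simp [u22AdaptedConj, u22FrameK, u22BaseGen, u22Kind, u22GenExplicit, offDiagA, offDiagB, Matrix.mul_apply, Fintype.sum_sum_type,
      Fin.sum_univ_two, Matrix.one_apply] <;>
    ring1

/-- `X_5 = g_5 X⁰_5 g_5⁻¹` computed. [folklore] -/
theorem u22Gen_eq_explicit_5 : u22Gen 5 = u22GenExplicit 5 := by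
  rw [u22Gen, Units.mul_inv_eq_iff_eq_mul]
  ext x y
  rcases x with a | b <;> rcases y with a' | b' <;> (try fin_cases a) <;> (try fin_cases b) <;> (try fin_cases a') <;> (try fin_cases b') <;>
    simp [u22AdaptedConj, u22FrameK, u22BaseGen, u22Kind, u22GenExplicit, offDiagA, offDiagB, Matrix.mul_apply, Fintype.sum_sum_type,
      Fin.sum_univ_two, Matrix.diagonal, Matrix.one_apply] <;>
    (first | ring1 | (ring_nf; simp only [Complex.I_sq]; ring_nf))

/-- `X_6 = g_6 X⁰_6 g_6⁻¹` computed. [folklore] -/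
theorem u22Gen_eq_explicit_6 : u22Gen 6 = u22GenExplicit 6 := by
  rw [u22Gen, Units.mul_inv_eq_iff_eq_mul]
  ext x y
  rcases x with a | b <;> rcases y with a' | b' <;> (try fin_cases a) <;> (try fin_cases b) <;> (try fin_cases a') <;> (try fin_cases b') <;>
    simp [u22AdaptedConj, u22FrameK, u22BaseGen, u22Kind, u22GenExplicit, offDiagA, offDiagB, Matrix.mul_apply, Fintype.sum_sum_type,
      Fin.sum_univ_two, Matrix.one_apply] <;>
    ring1

/-- `X_7 = g_7 X⁰_7 g_7⁻¹` computed. [folklore] -/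
theorem u22Gen_eq_explicit_7 : u22Gen 7 = u22GenExplicit 7 := by
  rw [u22Gen, Units.mul_inv_eq_iff_eq_mul]
  ext x y
  rcases x with a | b <;> rcases y with a' | b' <;> (try fin_cases a) <;> (try fin_cases b) <;> (try fin_cases a') <;> (try fin_cases b') <;>
    simp [u22AdaptedConj, u22FrameK, u22BaseGen, u22Kind, u22GenExplicit, offDiagA, offDiagB, Matrix.mul_apply, Fintype.sum_sum_type,
      Fin.sum_univ_two, Matrix.diagonal, Matrix.one_apply] <;>
    (first | ring1 | (ring_nf; simp only [Complex.I_sq]; ring_nf))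

/-- `X_8 = g_8 X⁰_8 g_8⁻¹` computed. [folklore] -/
theorem u22Gen_eq_explicit_8 : u22Gen 8 = u22GenExplicit 8 := by
  rw [u22Gen, Units.mul_inv_eq_iff_eq_mul]
  ext x y
  rcases x with a | b <;> rcases y with a' | b' <;> (try fin_cases a) <;> (try fin_cases b) <;> (try fin_cases a') <;> (try fin_cases b') <;>
    simp [u22AdaptedConj, u22FrameK, u22BaseGen, u22Kind, u22GenExplicit, offDiagA, offDiagB, Matrix.mul_apply, Matrix.one_apply]

/-- `X_9 = g_9 X⁰_9 g_9⁻¹` computed. [folklore] -/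
theorem u22Gen_eq_explicit_9 : u22Gen 9 = u22GenExplicit 9 := by
  rw [u22Gen, Units.mul_inv_eq_iff_eq_mul]
  ext x y
  rcases x with a | b <;> rcases y with a' | b' <;> (try fin_cases a) <;> (try fin_cases b) <;> (try fin_cases a') <;> (try fin_cases b') <;>
    simp [u22AdaptedConj, u22FrameK, u22BaseGen, u22Kind, u22GenExplicit, offDiagA, offDiagB, Matrix.mul_apply, Matrix.one_apply]

/-- `X_10 = g_10 X⁰_10 g_10⁻¹` computed. [folklore] -/
theorem u22Gen_eq_explicit_10 : u22Gen 10 = u22GenExplicit 10 := by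
  rw [u22Gen, Units.mul_inv_eq_iff_eq_mul]
  ext x y
  rcases x with a | b <;> rcases y with a' | b' <;> (try fin_cases a) <;> (try fin_cases b) <;> (try fin_cases a') <;> (try fin_cases b') <;>
    simp [u22AdaptedConj, u22FrameK, u22BaseGen, u22Kind, u22GenExplicit, offDiagA, offDiagB, Matrix.mul_apply, Matrix.one_apply]

/-- `X_11 = g_11 X⁰_11 g_11⁻¹` computed. [folklore] -/
theorem u22Gen_eq_explicit_11 : u22Gen 11 = u22GenExplicit 11 := by
  rw [u22Gen, Units.mul_inv_eq_iff_eq_mul]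
  ext x y
  rcases x with a | b <;> rcases y with a' | b' <;> (try fin_cases a) <;> (try fin_cases b) <;> (try fin_cases a') <;> (try fin_cases b') <;>
    simp [u22AdaptedConj, u22FrameK, u22BaseGen, u22Kind, u22GenExplicit, offDiagA, offDiagB, Matrix.mul_apply, Matrix.one_apply]

/-- `X_12 = g_12 X⁰_12 g_12⁻¹` computed. [folklore] -/
theorem u22Gen_eq_explicit_12 : u22Gen 12 = u22GenExplicit 12 := by
  rw [u22Gen, Units.mul_inv_eq_iff_eq_mul]
  ext x y
  rcases x with a | b <;> rcases y with a' | b' <;> (try fin_cases a) <;> (try fin_cases b) <;> (try fin_cases a') <;> (try fin_cases b') <;>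
    simp [u22AdaptedConj, u22FrameK, u22BaseGen, u22Kind, u22GenExplicit, offDiagA, offDiagB, Matrix.mul_apply, Fintype.sum_sum_type,
      Matrix.diagonal, Matrix.one_apply]

/-- `X_13 = g_13 X⁰_13 g_13⁻¹` computed. [folklore] -/
theorem u22Gen_eq_explicit_13 : u22Gen 13 = u22GenExplicit 13 := by
  rw [u22Gen, Units.mul_inv_eq_iff_eq_mul]
  ext x y
  rcases x with a | b <;> rcases y with a' | b' <;> (try fin_cases a) <;> (try fin_cases b) <;> (try fin_cases a') <;> (try fin_cases b') <;>
    simp [u22AdaptedConj, u22FrameK, u22BaseGen, u22Kind, u22GenExplicit, offDiagA, offDiagB, Matrix.mul_apply, Fintype.sum_sum_type,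
      Matrix.diagonal, Matrix.one_apply]

/-- `X_14 = g_14 X⁰_14 g_14⁻¹` computed. [folklore] -/
theorem u22Gen_eq_explicit_14 : u22Gen 14 = u22GenExplicit 14 := by
  rw [u22Gen, Units.mul_inv_eq_iff_eq_mul]
  ext x y
  rcases x with a | b <;> rcases y with a' | b' <;> (try fin_cases a) <;> (try fin_cases b) <;> (try fin_cases a') <;> (try fin_cases b') <;>
    simp [u22AdaptedConj, u22FrameK, u22BaseGen, u22Kind, u22GenExplicit, offDiagA, offDiagB, Matrix.mul_apply, Fintype.sum_sum_type,
      Matrix.diagonal, Matrix.one_apply]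

/-- `X_15 = g_15 X⁰_15 g_15⁻¹` computed. [folklore] -/
theorem u22Gen_eq_explicit_15 : u22Gen 15 = u22GenExplicit 15 := by
  rw [u22Gen, Units.mul_inv_eq_iff_eq_mul]
  ext x y
  rcases x with a | b <;> rcases y with a' | b' <;> (try fin_cases a) <;> (try fin_cases b) <;> (try fin_cases a') <;> (try fin_cases b') <;>
    simp [u22AdaptedConj, u22FrameK, u22BaseGen, u22Kind, u22GenExplicit, offDiagA, offDiagB, Matrix.mul_apply, Fintype.sum_sum_type,
      Matrix.diagonal, Matrix.one_apply]

/-- **`X_i = g_i X⁰_i g_i⁻¹` in closed form.** [folklore] -/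
theorem u22Gen_eq_explicit (i : Fin 16) : u22Gen i = u22GenExplicit i := by
  fin_cases i
  exacts [u22Gen_eq_explicit_0, u22Gen_eq_explicit_1, u22Gen_eq_explicit_2, u22Gen_eq_explicit_3, u22Gen_eq_explicit_4, u22Gen_eq_explicit_5,
    u22Gen_eq_explicit_6, u22Gen_eq_explicit_7, u22Gen_eq_explicit_8, u22Gen_eq_explicit_9, u22Gen_eq_explicit_10, u22Gen_eq_explicit_11,
    u22Gen_eq_explicit_12, u22Gen_eq_explicit_13, u22Gen_eq_explicit_14, u22Gen_eq_explicit_15]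

/-- the family `u22Gen` is the explicit family. [folklore] -/
theorem u22Gen_eq_explicit' : u22Gen = u22GenExplicit := funext u22Gen_eq_explicit

/-! ## Linear independence and spanning -/

/-- **Linear independence over `ℝ`** of the sixteen explicit generators (read off sixteen real coordinates of the entries). [folklore] -/
theorem linearIndependent_u22GenExplicit : LinearIndependent ℝ u22GenExplicit := by
  rw [Fintype.linearIndependent_iff]
  intro c hc
  rw [sum_univ_sixteen] at hc
  have e : ∀ x y, (c 0 • u22GenExplicit 0 + c 1 • u22GenExplicit 1 + c 2 • u22GenExplicit 2 + c 3 • u22GenExplicit 3 + c 4 • u22GenExplicit 4 +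
      c 5 • u22GenExplicit 5 + c 6 • u22GenExplicit 6 + c 7 • u22GenExplicit 7 + c 8 • u22GenExplicit 8 + c 9 • u22GenExplicit 9 +
      c 10 • u22GenExplicit 10 + c 11 • u22GenExplicit 11 + c 12 • u22GenExplicit 12 + c 13 • u22GenExplicit 13 + c 14 • u22GenExplicit 14 +
      c 15 • u22GenExplicit 15) x y = 0 := fun x y => by rw [hc]; rfl
  have h00 := congrArg Complex.im (e (Sum.inl 0) (Sum.inl 0))
  simp [u22GenExplicit, offDiagA, offDiagB, Matrix.add_apply, Matrix.smul_apply] at h00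
  have h11 := congrArg Complex.im (e (Sum.inl 1) (Sum.inl 1))
  simp [u22GenExplicit, offDiagA, offDiagB, Matrix.add_apply, Matrix.smul_apply] at h11
  have h22 := congrArg Complex.im (e (Sum.inr 0) (Sum.inr 0))
  simp [u22GenExplicit, offDiagA, offDiagB, Matrix.add_apply, Matrix.smul_apply] at h22
  have h33 := congrArg Complex.im (e (Sum.inr 1) (Sum.inr 1))
  simp [u22GenExplicit, offDiagA, offDiagB, Matrix.add_apply, Matrix.smul_apply] at h33
  have h01r := congrArg Complex.re (e (Sum.inl 0) (Sum.inl 1))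
  simp [u22GenExplicit, offDiagA, offDiagB, Matrix.add_apply, Matrix.smul_apply] at h01r
  have h01i := congrArg Complex.im (e (Sum.inl 0) (Sum.inl 1))
  simp [u22GenExplicit, offDiagA, offDiagB, Matrix.add_apply, Matrix.smul_apply] at h01i
  have h23r := congrArg Complex.re (e (Sum.inr 0) (Sum.inr 1))
  simp [u22GenExplicit, offDiagA, offDiagB, Matrix.add_apply, Matrix.smul_apply] at h23r
  have h23i := congrArg Complex.im (e (Sum.inr 0) (Sum.inr 1))
  simp [u22GenExplicit, offDiagA, offDiagB, Matrix.add_apply, Matrix.smul_apply] at h23i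
  have h02r := congrArg Complex.re (e (Sum.inl 0) (Sum.inr 0))
  simp [u22GenExplicit, offDiagA, offDiagB, Matrix.add_apply, Matrix.smul_apply] at h02r
  have h02i := congrArg Complex.im (e (Sum.inl 0) (Sum.inr 0))
  simp [u22GenExplicit, offDiagA, offDiagB, Matrix.add_apply, Matrix.smul_apply] at h02i
  have h03r := congrArg Complex.re (e (Sum.inl 0) (Sum.inr 1))
  simp [u22GenExplicit, offDiagA, offDiagB, Matrix.add_apply, Matrix.smul_apply] at h03r
  have h03i := congrArg Complex.im (e (Sum.inl 0) (Sum.inr 1))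
  simp [u22GenExplicit, offDiagA, offDiagB, Matrix.add_apply, Matrix.smul_apply] at h03i
  have h12r := congrArg Complex.re (e (Sum.inl 1) (Sum.inr 0))
  simp [u22GenExplicit, offDiagA, offDiagB, Matrix.add_apply, Matrix.smul_apply] at h12r
  have h12i := congrArg Complex.im (e (Sum.inl 1) (Sum.inr 0))
  simp [u22GenExplicit, offDiagA, offDiagB, Matrix.add_apply, Matrix.smul_apply] at h12i
  have h13r := congrArg Complex.re (e (Sum.inl 1) (Sum.inr 1))
  simp [u22GenExplicit, offDiagA, offDiagB, Matrix.add_apply, Matrix.smul_apply] at h13r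
  have h13i := congrArg Complex.im (e (Sum.inl 1) (Sum.inr 1))
  simp [u22GenExplicit, offDiagA, offDiagB, Matrix.add_apply, Matrix.smul_apply] at h13i
  intro i
  fin_cases i <;> simp <;> linarith

/-- **Linear independence over `ℝ` of `X₀, …, X₁₅`.** [folklore] -/
theorem linearIndependent_u22Gen : LinearIndependent ℝ u22Gen := by
  rw [u22Gen_eq_explicit']
  exact linearIndependent_u22GenExplicit

/-- **Coordinates on `𝔲(2,2)`** adapted to `X₀, …, X₁₅`: real-linear functionals of the entries. [folklore] -/
def u22Coeff (X : Matrix (Fin 2 ⊕ Fin 2) (Fin 2 ⊕ Fin 2) ℂ) : Fin 16 → ℝ :=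
  ![(X (Sum.inl 0) (Sum.inl 0)).im - 7 / 24 * ((X (Sum.inl 0) (Sum.inl 1)).im + (X (Sum.inl 0) (Sum.inl 1)).re),
    (X (Sum.inl 1) (Sum.inl 1)).im + 7 / 24 * ((X (Sum.inl 0) (Sum.inl 1)).im + (X (Sum.inl 0) (Sum.inl 1)).re),
    (X (Sum.inr 0) (Sum.inr 0)).im - 7 / 24 * ((X (Sum.inr 0) (Sum.inr 1)).im + (X (Sum.inr 0) (Sum.inr 1)).re),
    (X (Sum.inr 1) (Sum.inr 1)).im + 7 / 24 * ((X (Sum.inr 0) (Sum.inr 1)).im + (X (Sum.inr 0) (Sum.inr 1)).re),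
    -(25 / 24) * (X (Sum.inl 0) (Sum.inl 1)).im,
    -(25 / 24) * (X (Sum.inl 0) (Sum.inl 1)).re,
    -(25 / 24) * (X (Sum.inr 0) (Sum.inr 1)).im,
    -(25 / 24) * (X (Sum.inr 0) (Sum.inr 1)).re,
    -(X (Sum.inl 0) (Sum.inr 0)).im, -(X (Sum.inl 0) (Sum.inr 1)).im, -(X (Sum.inl 1) (Sum.inr 0)).im, -(X (Sum.inl 1) (Sum.inr 1)).im,
    (X (Sum.inl 0) (Sum.inr 0)).re, (X (Sum.inl 0) (Sum.inr 1)).re, (X (Sum.inl 1) (Sum.inr 0)).re, (X (Sum.inl 1) (Sum.inr 1)).re]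

/-- **Every `X ∈ 𝔲(2,2)` is the real combination `∑ u22Coeff X i • X_i`** (the constraints `Xᴴ D + D X = 0`: `X_pp ∈ iℝ`; `X₁₀ = −X̄₀₁`, `X₃₂ = −X̄₂₃` in
the compact blocks; `X_{q̄p} = X̄_{pq̄}` across). [folklore] -/
theorem eq_sum_u22Coeff_smul {X : Matrix (Fin 2 ⊕ Fin 2) (Fin 2 ⊕ Fin 2) ℂ} (hX : X ∈ (uFormGroup (Fin 2) (Fin 2)).lie) :
    X = ∑ i, u22Coeff X i • u22GenExplicit i := by
  have h := (mem_uFormGroup_lie_iff X).1 hX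
  have e : ∀ x y, (Xᴴ * signForm (Fin 2) (Fin 2) + signForm (Fin 2) (Fin 2) * X) x y = 0 := fun x y => by rw [h]; rfl
  have k00 := congrArg Complex.re (e (Sum.inl 0) (Sum.inl 0))
  simp [Matrix.add_apply, Matrix.mul_apply, Fintype.sum_sum_type, Matrix.fromBlocks, Matrix.conjTranspose_apply, Matrix.one_apply] at k00
  have k11 := congrArg Complex.re (e (Sum.inl 1) (Sum.inl 1))
  simp [Matrix.add_apply, Matrix.mul_apply, Fintype.sum_sum_type, Matrix.fromBlocks, Matrix.conjTranspose_apply, Matrix.one_apply] at k11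
  have k22 := congrArg Complex.re (e (Sum.inr 0) (Sum.inr 0))
  simp [Matrix.add_apply, Matrix.mul_apply, Fintype.sum_sum_type, Matrix.fromBlocks, Matrix.conjTranspose_apply, Matrix.one_apply] at k22
  have k33 := congrArg Complex.re (e (Sum.inr 1) (Sum.inr 1))
  simp [Matrix.add_apply, Matrix.mul_apply, Fintype.sum_sum_type, Matrix.fromBlocks, Matrix.conjTranspose_apply, Matrix.one_apply] at k33
  have k10r := congrArg Complex.re (e (Sum.inl 1) (Sum.inl 0))
  simp [Matrix.add_apply, Matrix.mul_apply, Fintype.sum_sum_type, Matrix.fromBlocks, Matrix.conjTranspose_apply, Matrix.one_apply] at k10r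
  have k10i := congrArg Complex.im (e (Sum.inl 1) (Sum.inl 0))
  simp [Matrix.add_apply, Matrix.mul_apply, Fintype.sum_sum_type, Matrix.fromBlocks, Matrix.conjTranspose_apply, Matrix.one_apply] at k10i
  have k32r := congrArg Complex.re (e (Sum.inr 1) (Sum.inr 0))
  simp [Matrix.add_apply, Matrix.mul_apply, Fintype.sum_sum_type, Matrix.fromBlocks, Matrix.conjTranspose_apply, Matrix.one_apply] at k32r
  have k32i := congrArg Complex.im (e (Sum.inr 1) (Sum.inr 0))
  simp [Matrix.add_apply, Matrix.mul_apply, Fintype.sum_sum_type, Matrix.fromBlocks, Matrix.conjTranspose_apply, Matrix.one_apply] at k32i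
  have k20r := congrArg Complex.re (e (Sum.inr 0) (Sum.inl 0))
  simp [Matrix.add_apply, Matrix.mul_apply, Fintype.sum_sum_type, Matrix.fromBlocks, Matrix.conjTranspose_apply, Matrix.one_apply] at k20r
  have k20i := congrArg Complex.im (e (Sum.inr 0) (Sum.inl 0))
  simp [Matrix.add_apply, Matrix.mul_apply, Fintype.sum_sum_type, Matrix.fromBlocks, Matrix.conjTranspose_apply, Matrix.one_apply] at k20i
  have k21r := congrArg Complex.re (e (Sum.inr 0) (Sum.inl 1))
  simp [Matrix.add_apply, Matrix.mul_apply, Fintype.sum_sum_type, Matrix.fromBlocks, Matrix.conjTranspose_apply, Matrix.one_apply] at k21r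
  have k21i := congrArg Complex.im (e (Sum.inr 0) (Sum.inl 1))
  simp [Matrix.add_apply, Matrix.mul_apply, Fintype.sum_sum_type, Matrix.fromBlocks, Matrix.conjTranspose_apply, Matrix.one_apply] at k21i
  have k30r := congrArg Complex.re (e (Sum.inr 1) (Sum.inl 0))
  simp [Matrix.add_apply, Matrix.mul_apply, Fintype.sum_sum_type, Matrix.fromBlocks, Matrix.conjTranspose_apply, Matrix.one_apply] at k30r
  have k30i := congrArg Complex.im (e (Sum.inr 1) (Sum.inl 0))
  simp [Matrix.add_apply, Matrix.mul_apply, Fintype.sum_sum_type, Matrix.fromBlocks, Matrix.conjTranspose_apply, Matrix.one_apply] at k30i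
  have k31r := congrArg Complex.re (e (Sum.inr 1) (Sum.inl 1))
  simp [Matrix.add_apply, Matrix.mul_apply, Fintype.sum_sum_type, Matrix.fromBlocks, Matrix.conjTranspose_apply, Matrix.one_apply] at k31r
  have k31i := congrArg Complex.im (e (Sum.inr 1) (Sum.inl 1))
  simp [Matrix.add_apply, Matrix.mul_apply, Fintype.sum_sum_type, Matrix.fromBlocks, Matrix.conjTranspose_apply, Matrix.one_apply] at k31i
  rw [sum_univ_sixteen]
  ext x y
  rcases x with a | b <;> rcases y with a' | b' <;> (try fin_cases a) <;> (try fin_cases b) <;> (try fin_cases a') <;> (try fin_cases b') <;>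
    simp [u22Coeff, u22GenExplicit, offDiagA, offDiagB, Matrix.add_apply, Matrix.smul_apply, Complex.ext_iff] <;>
    (try constructor) <;> linarith

/-- **Spanning**: `𝔲(2,2) ⊆ span_ℝ {X₀, …, X₁₅}`. [folklore] -/
theorem mem_span_u22Gen {X : Matrix (Fin 2 ⊕ Fin 2) (Fin 2 ⊕ Fin 2) ℂ} (hX : X ∈ (uFormGroup (Fin 2) (Fin 2)).lie) :
    X ∈ Submodule.span ℝ (Set.range u22Gen) := by
  rw [eq_sum_u22Coeff_smul hX, u22Gen_eq_explicit']
  exact Submodule.sum_mem _ fun i _ => Submodule.smul_mem _ _ (Submodule.subset_span (Set.mem_range_self i))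

/-! ## The basis and the exponential table in `U(2,2)` -/

/-- the adapted generators as elements of the real vector space `𝔲(2,2)`. [folklore] -/
def u22GenMem (i : Fin 16) : ↥(uFormGroup (Fin 2) (Fin 2)).lie.toSubmodule := ⟨u22Gen i, u22Gen_mem_lie i⟩

/-- coercion of `u22GenMem i`. [folklore] -/
@[simp] theorem coe_u22GenMem (i : Fin 16) :
    ((u22GenMem i : ↥(uFormGroup (Fin 2) (Fin 2)).lie.toSubmodule) : Matrix (Fin 2 ⊕ Fin 2) (Fin 2 ⊕ Fin 2) ℂ) = u22Gen i := rfl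

/-- linear independence of `u22GenMem`. [folklore] -/
theorem linearIndependent_u22GenMem : LinearIndependent ℝ u22GenMem :=
  LinearIndependent.of_comp (uFormGroup (Fin 2) (Fin 2)).lie.toSubmodule.subtype linearIndependent_u22Gen

/-- `u22GenMem` spans `𝔲(2,2)`. [folklore] -/
theorem span_u22GenMem : ⊤ ≤ Submodule.span ℝ (Set.range u22GenMem) := by
  rintro ⟨X, hX⟩ -
  have hsum : (⟨X, hX⟩ : ↥(uFormGroup (Fin 2) (Fin 2)).lie.toSubmodule) = ∑ i, u22Coeff X i • u22GenMem i := by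
    apply Subtype.ext
    rw [Submodule.coe_sum]
    simp only [Submodule.coe_smul, coe_u22GenMem, u22Gen_eq_explicit']
    exact eq_sum_u22Coeff_smul hX
  rw [hsum]
  exact Submodule.sum_mem _ fun i _ => Submodule.smul_mem _ _ (Submodule.subset_span (Set.mem_range_self i))

/-- **The adapted basis of `𝔲(2,2)`**: `X₀, …, X₁₅`, each of whose one-parameter groups is a `K`-conjugate of a compact torus or of a boost `hypV p q`
(dimension count `dim_ℝ 𝔲(2,2) = 16`). [cite: Knapp2002, I.§1 Example (3)] -/
def u22AdaptedBasis : Module.Basis (Fin 16) ℝ ↥(uFormGroup (Fin 2) (Fin 2)).lie.toSubmodule :=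
  Module.Basis.mk linearIndependent_u22GenMem span_u22GenMem

/-- **`dim_ℝ 𝔲(2,2) = 16`.** [cite: Knapp2002, I.§1 Example (3)] -/
theorem finrank_u22Lie : Module.finrank ℝ ↥(uFormGroup (Fin 2) (Fin 2)).lie.toSubmodule = 16 := by
  simpa using Module.finrank_eq_card_basis u22AdaptedBasis

/-- `u22AdaptedBasis i = X_i`. [folklore] -/
@[simp] theorem coe_u22AdaptedBasis (i : Fin 16) :
    ((u22AdaptedBasis i : ↥(uFormGroup (Fin 2) (Fin 2)).lie.toSubmodule) : Matrix (Fin 2 ⊕ Fin 2) (Fin 2 ⊕ Fin 2) ℂ) = u22Gen i := by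
  rw [u22AdaptedBasis, Module.Basis.mk_apply, coe_u22GenMem]

/-- the adapted generators as elements of the Lie algebra (the `X` of ★ `RealMatrixGroup.contDiffAt_apply_of_letters`). [folklore] -/
def u22X (i : Fin 16) : ↥(uFormGroup (Fin 2) (Fin 2)).lie := ⟨u22Gen i, u22Gen_mem_lie i⟩

/-- `u22X i` and `u22AdaptedBasis i` have the same matrix (the `hXb` of ★ `contDiffAt_apply_of_letters`). [folklore] -/
theorem coe_u22X_eq (i : Fin 16) :
    ((u22X i : ↥(uFormGroup (Fin 2) (Fin 2)).lie) : Matrix (Fin 2 ⊕ Fin 2) (Fin 2 ⊕ Fin 2) ℂ) =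
      ((u22AdaptedBasis i : ↥(uFormGroup (Fin 2) (Fin 2)).lie.toSubmodule) : Matrix (Fin 2 ⊕ Fin 2) (Fin 2 ⊕ Fin 2) ℂ) := by
  rw [coe_u22AdaptedBasis]
  rfl

/-- **The exponential table in `U(2,2)`** (conjugator ∕ one-parameter-group form): `expMem (s · X_i) = g_i L_i(s) g_i⁻¹`. [cite: Knapp2002, VI.§2] -/
theorem expMem_smul_u22X (i : Fin 16) (s : ℝ) :
    (uFormGroup (Fin 2) (Fin 2)).expMem (s • u22X i) = u22AdaptedConj i * u22AdaptedOneParam i s * (u22AdaptedConj i)⁻¹ := by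
  apply Subtype.ext
  rw [RealMatrixGroup.coe_expMem]
  exact expGL_smul_u22Gen i s

/-- **The exponential table in `U(2,2)`** (basis form): `expMem (s · u22AdaptedBasis i) = g_i L_i(s) g_i⁻¹`. [cite: Knapp2002, VI.§2] -/
theorem expMem_smul_u22AdaptedBasis' (i : Fin 16) (s : ℝ) :
    (uFormGroup (Fin 2) (Fin 2)).expMem (s • u22AdaptedBasis i) = u22AdaptedConj i * u22AdaptedOneParam i s * (u22AdaptedConj i)⁻¹ := by
  apply Subtype.ext
  rw [RealMatrixGroup.coe_expMem]
  change expGL (s • ((u22AdaptedBasis i : ↥(uFormGroup (Fin 2) (Fin 2)).lie.toSubmodule) : Matrix (Fin 2 ⊕ Fin 2) (Fin 2 ⊕ Fin 2) ℂ)) = _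
  rw [coe_u22AdaptedBasis, expGL_smul_u22Gen]

/-- **The exponential table in `U(2,2)`** — the shape consumed by ★ `ArchimedeanSecondKindChart` ∕ `contDiffAt_apply_of_letters` (`ρ (expMem (s • B i))`), with
the frame and the letter read off the two index functions:
`expMem (s · u22AdaptedBasis i) = kV (u22FrameK i) * letterOf (u22Kind i) s * (kV (u22FrameK i))⁻¹`. [cite: Knapp2002, VI.§2] -/
theorem expMem_smul_u22AdaptedBasis (i : Fin 16) (s : ℝ) :
    (uFormGroup (Fin 2) (Fin 2)).expMem (s • u22AdaptedBasis i) =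
      kV (Fin 2) (Fin 2) (u22FrameK i) * letterOf (u22Kind i) s * (kV (Fin 2) (Fin 2) (u22FrameK i))⁻¹ :=
  expMem_smul_u22AdaptedBasis' i s

end Summit.HodgeConjecture.HodgeConjecture.Cruxes.HLiu418.K2LiuU22AdaptedBasis

end
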